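import Summits.BirchSwinnertonDyer.Rank1Residual.Supersingular.KobayashiMainConjectureX7
import Summits.BirchSwinnertonDyer.Rank1Residual.Supersingular.KobayashiMainConjectureX6BSTWScopeS
import Summits.BirchSwinnertonDyer.Rank1Residual.Supersingular.SignedMainStatementBridge
import Literature.NumberTheory.EllipticCurves.BurungaleSkinnerTianWan2024.QuadraticTwistPPartOPEN
import Literature.NumberTheory.QuadraticFields.ImaginaryQuadraticPrescribedSplittingInert
import HarnessLib

/-!
# Kobayashi's signed main conjecture on the real objects — the TWIST CLAUSE of Burungale–Skinner–Tian–Wan Thm. 10.1 /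
# Cor. 10.2 (Thm. 1.3 / 1.5) on the TWIST SCOPE `S_tw` of the litref D-audit: the twisting field `K = ℚ(√d)` is ITSELF
# an admissible auxiliary field of the printed proof for `(E₀, p)` (cell `pub/bsd-litref`, sub-dir `bstw24`, typer seat
# `bsd-litref-bstw24-ty` gen 7–8; companion of `KobayashiMainConjectureX7.lean` (printed intro-wording twist binder
# `BurungaleSkinnerTianWan2024_thm13_twist_OPEN`) and of `KobayashiMainConjectureX6BSTWScopeS.lean` (S-tiers, SEMISTABLE clause))

HONEST FRAMING (run/shared/lean/pub/bsd-litref/README.md; programme BSD-LIT2PART v1 §HONESTY, verbatim): «no tranche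
here proves BSD; ARM L moves the LITERAL column of an r ≤ 1 census into the kernel-proved-modulo-named-print column; ARM
P changes what "named print" is worth.» The source arXiv:2409.01350v2 is an UNREFEREED PREPRINT: it enters ONLY as
explicitly labelled OPEN hypotheses (`def … : Prop`, `[claim: …, status: under-review]`), NEVER as theorems, facts or
`_holds`; nothing about any curve is asserted; class X7 (`GoodSS ∧ ¬Semistable`) stays CONSTRUCTION-SHAPED; nothing is
booked here (bookings are referee A's). Typed ≠ proved ≠ endorsed.

WHY THIS FILE (D-0120 / W-ALL exclusion row 7 «X7 = GoodSS ∧ ¬Semistable»; bstw24-pv g5 census; lead 03:04:26Z): the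
twist clause of BSTW Thm. 1.3 / 1.5 (body: Thm. 10.1 / Cor. 10.2) is the ONLY print object that bites on row 7; its
consumers are kernel-wired BY NAME on the PRINTED binders (`X7.bsdp_of_BSTW13_twist_OPEN_of_analyticRank_eq_zero`,
`bsdp_of_thm15_twist_OPEN'`, `bsdp_of_cor102_twist_OPEN`, `WAll.cornerX7_bodyTwist_of_bstwCor102_OPEN`). The litref
D-audit of the twist clause WITH A SCOPE (TeX source of record 5926f035551c636d) reads the printed proof as follows.
ROAD B1 (as the authors intend, §10.3 l.7478 «The same argument applies for the quadratic twist g_K»: re-run §10.3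
for the form `g_K` of level `N·D_K²` with an auxiliary `L`) needs two inputs OUTSIDE the letter of refereed print —
(T1) Thm. 9.24's twist sentence l.7273, whose proof l.7282–7285 is an ASSERTED adaptation of [CLW, Thm. 8.2.3] and
[W1] beyond their printed semistable-conductor hypotheses, and (T2b) in Thm. 10.5's μ-step, l.7427–7428, the period-
ratio identity at the NON-square-free Eichler level `(N/q)·D_K²`, whose freeness half is printed for ORDINARY `p` only
([KO23] = arXiv:1905.02926, Thm. 1.3 with Rem. 5.6 / 6.5 «we omit it»); the citation l.7421–7425 «by [PW, Thm. 1.2]»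
(T2a) is outside [PW]'s square-free letter but closable in print ([Vat03] §§4.6–5 + [PW11, Thm. 2.5]; [CH18, Cor.
5.2]) — verdict GAP(line) at (T1) ∧ (T2b), two readers CONCUR; a witness of II §2.3's auxiliary data taken ON THE
TWIST is road B1's datum and carries (T1) ∧ (T2b), so it is NOT typed here. ROAD B2 (the scope road): when the
TWISTING field `K` is imaginary quadratic and satisfies, for `(g = f_{E₀}, p)`, every condition §10.3 puts on ITS
auxiliary field `L` (l.7457–7459: a (ram) prime `q ∥ N` inert in `K`, the primes of `N/q` split, (ord) `p` split,
`(D_K, 2N) = 1`; plus (spl)'s 2-clause of Thm. 9.24, l.7263), the printed proof of Thm. 10.1 FOR `g`, run with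
`L := K`, displays (l.7465–7468) `𝓛_γ(g)·𝓛_γ′(g′) ∣ ξ(X∘(g))·ξ(X∘(g′))` and (l.7470–7472) `ξ(X∘(g)) ∣ 𝓛^∘_γ(g)`,
`ξ(X∘(g′)) ∣ 𝓛^∘_γ′(g′)` for `g′ = g ⊗ χ_L = g_K`; the printed «Therefore ξ(X∘(g)) = (𝓛^∘_γ(g))» (l.7473–7475) is
the unit argument in the domain `Λ_{𝒪_λ}`, which yields `ξ(X∘(g_K)) = (𝓛^∘_γ′(g_K))` in the same breath — NO object of
level `N·D_K²` enters. Hence on `S_tw` the twist clause has EXACTLY the epistemic status of the untwisted clause on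
`(E₀, p)` with the auxiliary pair `(q, K)`: the `p ≥ 5` tier (PASS-in-cell with the cell repairs; C4-R3 (γ)(ζ)) and
the `p = 3` tier (GAP(line) of record ⇐ [SV-S-Ohta]; C4-R3 (β)), plus the one-conjunct reader repair at l.7473–7475.
In the tree's vocabulary `S_tw` is `BSTWScope.IsAuxiliaryTwist W₀ p d` below: SOME (ram) prime `q` of `W₀`
(`BSTWScope.IsAuxiliaryPrime W₀ p q`) and the quadratic field `K` of discriminant `d` with
`BSTWScope.IsAuxiliaryField W₀ p q K` — both predicates are the X6 scope file's, UNCHANGED; the only new atom is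
«`K` is the field of discriminant `d`» (elementary reading from decidable data: `BSTWScope.isAuxiliaryTwist_of_kronecker`).
`S_tw` lies inside the BODY family (discriminant coprime to `Np`) and is NOT inside the intro family (the primes of `d`
are good for `E₀`, ordinary OR supersingular), so the binders below scope the BODY wording (Thm. 10.1 l.7322 / Cor.
10.2 l.7341), exact S-twins of the Literature body
binders `thm101_twist_signedMainStatement_OPEN` (main-conjecture level; conclusion converted to the Summits currency
`KobayashiMainConjecture` by the tree's `kobayashiMainConjecture_of_signedCharIdealEq`) and `cor102_twist_pPart_OPEN`
(`p`-part level), each weaker-or-equal to print by construction (`…_of_thm101_twist_OPEN`, `…_of_cor102_twist_OPEN`),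
never stronger; VERDICT-NEUTRAL (a `Prop` names a hypothesis). Outside `S_tw` (real `K`, `p` inert in `K`, no or
evenly many inert (ram) primes, `2 ∣ d_K`, `2` good and not split) the unscoped printed binders stay as they are (PRE,
announced) with the located residual typed BY NAME: (T1) = `thm924_twist_greenberg_dvd_charIdealXGr₂_awayFromCyc_OPEN`
restricted to `L` with the primes of `D_K` split; (T2b) = freeness of the definite quaternionic Hecke module at Eichler
level `(N/q)·D_K²` localised at `𝔪_{g_K}`, `p` supersingular (no carrier in the tree; words, not a `[cite]` fact).

SHEET VERDICTS OF RECORD (`pub/bsd-litref/bstw24/sheets/D-AUDIT-bstw24-r{1,2}-TWIST[-ADDENDUM-1].md`). Reader 2 (blind,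
sealed 2026-08-27T04:09Z) 12a33d6b09c94339 + ADDENDUM-1 5d731181c47ec60d: V1 statements VERBATIM (body binders) resp.
weaker than print (intro binders B3, B4), CONCUR C4-R3 (α), no RETURN, no SMUGGLED; V2 road B1 GAP(line) at l.7282–7285
(T1) ∧ l.7427–7428 (T2b), the citation l.7421–7425 (T2a) closable in print; V3 road B2 PASS-in-cell(scope `S_tw`) WITH
A ONE-CONJUNCT READER REPAIR at l.7473–7475, modulo exactly the untwisted tiers of record (S5 at `p ≥ 5`, S3 at
`p = 3`); V4 Cor. 10.2 / Thm. 1.5 / 1.6 twist deductions PASS-in-cell modulo PUB at any conductor; ADD-1 §4: the typed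
scope `BSTWScope.IsAuxiliaryTwist` below = the sheet's `S_tw` VERBATIM, tier binders faithful, no RETURN. Reader 1
(primary; sealed 04:29Z before opening reader 2's sheet) f4111aa165ebbd47 + ADDENDUM-1 16a3b3eea074a1c6: statements
VERBATIM ×4 (intro weaker than body); road B1 GAP(line) l.7282–7285 with the twist-specific sub-gap l.7427–7428; the
blind «S_tw(refereed) = ∅» WITHDRAWN in the addendum, which CONCEDES and CONCURS reader 2's V3 (scope `S_tw^aux` = the
predicate below, tiers S5 and S3 of record) — no disagreement of verdict kind remains between the readers on any TWIST
object. Referee C4 (`pub-bsdpct-r7`; three wakes + reader 2's ADD-1 in one slot), ROUND C4-R3-ADD-6 (desk stamp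
2026-08-27T07:25:00Z, `pub-bsdpct/REFEREE.md` l.7934): all five records REGISTERED and CONFIRMED — (α) statements
VERBATIM ×4, no line to the typist; (β) road B1 GAP(line) T1 l.7282–7285 ∧ T2b l.7427–7428, T2a closable in print;
(γ) road B2 «PASS-in-cell(scope S_tw^aux) WITH THE ONE-CONJUNCT READER REPAIR at [L7473–7475]» (re-derived at the
desk; a domain suffices) «modulo EXACTLY the untwisted tiers of record» S5 / S3; (b) «THE SCOPE OBJECT IS NAMED»: this
file, STRICT first alternative only, filing condition «the Kronecker helper must read the full decomposition law at
q = 2» (met below), the (def)-variant an option only if typed to l.7390–7391's letter; 0 cells move at the desk.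

WHAT IS NOT HERE: the per-pair discharge of `S_tw` (bstw24-pv, via `BSTWScope.isAuxiliaryTwist_of_kronecker`); the
twist's automatic hypotheses (`X7TwistClauseOPEN.lean`, `…_of_twistClause`); any `p = 3` discharge; road B1.

## References
* [BurungaleSkinnerTianWan2024] arXiv:2409.01350v2 (TeX 5926f035551c636d): Thm. 1.3 / 1.5 twist clause (pp. 3–4; l.446–447 / l.473); Thm. 10.1
  (p. 86; label KoMC_r, l.7315–7323, twist sentence l.7322); Cor. 10.2 (p. 86; label BSD_f_Ko, l.7328–7342, twist
  sentence l.7341; proof l.7343–7358); Thm. 10.5 (p. 87; label KoMC'_lb, l.7387–7404; (def) l.7390–7391; μ-step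
  l.7421–7425); (ram) l.7184–7185; Thm. 9.24 (label GMC_r, l.7258–7274; (spl) l.7263; twist sentence l.7273; proof
  l.7275–7286); §10.3 proof of Thm. 10.1 (p. 88; l.7454–7479: auxiliary data l.7457–7459, displays l.7465–7472,
  «Therefore» l.7473–7475, twist sentence l.7478).
* [Kobayashi2003] Main Conjecture (p. 2); [SkinnerUrban2014] Thm. 2 (p. 3), second bullet ((ram)); [Cox2013] §7.B
  Thm. 7.7 (ii), [Marcus2018] Ch. 3 Thm. 25 (decomposition law). Litref record: sheets D-AUDIT-bstw24-r1.md 2ab68891cb7b08bc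
  (O2) + D-AUDIT-bstw24-r2.md 69e4de3690fd21dc (N2), referee C4 ROUND C4-R3 (α) (2026-08-27T00:54:31Z); the TWIST records above.
-/

set_option autoImplicit false

noncomputable section

open scoped Classical MatrixGroups ModularForm

open CongruenceSubgroup WeierstrassCurve Literature.NumberTheory.EllipticCurves
  Literature.NumberTheory.EllipticCurves.ModularForms
  Literature.NumberTheory.EllipticCurves.Rank1Residual
  Literature.NumberTheory.EllipticCurves.Rank1Residual.Typed
  Literature.NumberTheory.EllipticCurves.BurungaleSkinnerTianWan2024
  Literature.NumberTheory.EllipticCurves.Kobayashi2003 ZpExtension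

namespace Summit.BirchSwinnertonDyer.Rank1Residual.Supersingular

/-! ### § Scope — the twist scope `S_tw` as a predicate on `(W₀, p, d)`, and its kernel form from decidable data -/

section Scope

/-- **The TWIST SCOPE `S_tw` of the litref D-audit (reader 2, sheet 12a33d6b09c94339 §C.1): the twisting field
`K = ℚ(√d)` is ITSELF an admissible auxiliary field of the printed proof of BSTW Thm. 10.1 for `(E₀, p)`.** There are
a prime `q` with `BSTWScope.IsAuxiliaryPrime W₀ p q` (the (ram) prime of II §10.3 l.7457: `q ≠ p`, multiplicative for
`W₀`, `p ∤ ord_q(Δ_min)`) and a quadratic number field `K` of discriminant `d` with `BSTWScope.IsAuxiliaryField W₀ p q K`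
(II §10.3 l.7458–7459 read with `L := K`: `K` imaginary quadratic, `p` split, `q` inert, every other bad prime of `W₀`
split, `d_K` odd and prime to every bad prime, `2` split if `2` is good). Both conjunct predicates are the X6 scope
file's, unchanged; `K` is pinned by `finrank_ℚ K = 2 ∧ discr K = d` (for square-free `d` this forces `d ≡ 1 (mod 4)`,
as the oddness clause of `IsAuxiliaryField` requires anyway). As in the X6 file only the FIRST alternative of l.7459 («q
inert and the primes dividing N∕q split») is typed; the wider (def)-variant (oddly many inert (ram) primes) is covered
by the same reading but not spelled here. A predicate; nothing asserted.
[cite: SkinnerUrban2014, Thm. 2 (p. 3), second bullet (shape of (ram) only; nothing asserted)] -/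
def BSTWScope.IsAuxiliaryTwist (W₀ : WeierstrassCurve ℚ) [W₀.IsGloballyMinimal] (p : ℕ) (d : ℤ) : Prop :=
  ∃ (q : ℕ) (_ : Fact q.Prime) (K : Type) (_ : Field K) (_ : NumberField K),
    Module.finrank ℚ K = 2 ∧ NumberField.discr K = d ∧
      BSTWScope.IsAuxiliaryPrime W₀ p q ∧ BSTWScope.IsAuxiliaryField W₀ p q K

/-- On the twist scope the pair `(q, K)` is in particular a class-number-free scope witness of the UNTWISTED reading
for `(W₀, p)` (`BSTWScope.HasAuxWitness`, the S-tiers' hypothesis): `S_tw` sits inside the S5∕S3 domain. [folklore] -/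
theorem BSTWScope.hasAuxWitness_of_isAuxiliaryTwist (W₀ : WeierstrassCurve ℚ) [W₀.IsGloballyMinimal] (p : ℕ)
    {d : ℤ} (h : BSTWScope.IsAuxiliaryTwist W₀ p d) : BSTWScope.HasAuxWitness W₀ p :=
  let ⟨q, hq, K, hF, hN, _, _, haux, hfield⟩ := h; ⟨q, hq, K, hF, hN, haux, hfield⟩

open Literature.NumberTheory.QuadraticFields in
/-- **The twist scope from DECIDABLE data** (the class-number-free twin of `BSTWScope.hasWitness_of_kronecker`, with
the auxiliary field recorded by its discriminant). For a globally minimal `W₀`, an odd prime `p`, a (ram) prime `q`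
(`BSTWScope.IsAuxiliaryPrime W₀ p q`) and a natural number `D` such that `−D` is an ODD negative fundamental
discriminant (`−D ≡ 1 (mod 4)`, square-free, `≠ 1`): if `(−D/p) = 1`, `q` is INERT — `(−D/q) = −1` for odd `q`,
`−D ≡ 5 (mod 8)` for `q = 2` (Mathlib's `jacobiSym · 2` is the Legendre character of `ZMod 2`, never `−1` on odd
arguments, so the full decomposition law at `2` is spelled out; prover seat bsd-litref-bstw24-pv g6) —, no bad prime
divides `D`, every bad `ℓ ≠ q` has `(−D/ℓ) = 1` (`−D ≡ 1 (mod 8)` for `ℓ = 2`) and `−D ≡ 1 (mod 8)` when `2` is good,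
then `(W₀, p, −D) ∈ S_tw`: `K = ℚ(√−D)` exists with `d_K = −D` (`Quadratic.exists_numberField_discr_eq`), is imaginary
quadratic (`isImaginaryQuadratic_iff_discr_neg`), and the splitting is the decomposition law
(`ncard_primesOver_eq_two_iff_jacobiSym`, `ncard_primesOver_two_eq_two_iff`, `…_eq_one_of_jacobiSym_eq_neg_one`,
`Quadratic.ncard_primesOver_two_eq_one_of_discr_mod_eight`). [cite: Cox2013, §7.B Thm. 7.7(ii)]
[cite: Marcus2018, Ch. 3 Thm. 25 (decomposition law at 2)] -/
theorem BSTWScope.isAuxiliaryTwist_of_kronecker (W₀ : WeierstrassCurve ℚ) [W₀.IsGloballyMinimal] (p : ℕ)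
    [Fact p.Prime] (hp2 : p ≠ 2) (q : ℕ) [hq : Fact q.Prime]
    (haux : BSTWScope.IsAuxiliaryPrime W₀ p q) (D : ℕ)
    (hfund : (-(D : ℤ)) % 4 = 1 ∧ Squarefree (-(D : ℤ)) ∧ (-(D : ℤ)) ≠ 1)
    (hsp : jacobiSym (-(D : ℤ)) p = 1)
    (hin : (q = 2 → (-(D : ℤ)) % 8 = 5) ∧ (q ≠ 2 → jacobiSym (-(D : ℤ)) q = -1))
    (hbadD : ∀ ℓ : ℕ, (hℓ : ℓ.Prime) →
      (haveI : Fact ℓ.Prime := ⟨hℓ⟩; ¬ W₀.HasGoodReductionAtPrime ℓ) → ¬ (ℓ : ℤ) ∣ (D : ℤ))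
    (hbad : ∀ ℓ : ℕ, (hℓ : ℓ.Prime) → ℓ ≠ q →
      (haveI : Fact ℓ.Prime := ⟨hℓ⟩; ¬ W₀.HasGoodReductionAtPrime ℓ) →
        (ℓ = 2 → (-(D : ℤ)) % 8 = 1) ∧ (ℓ ≠ 2 → jacobiSym (-(D : ℤ)) ℓ = 1))
    (htwo : W₀.HasGoodReductionAtPrime 2 → (-(D : ℤ)) % 8 = 1) :
    BSTWScope.IsAuxiliaryTwist W₀ p (-(D : ℤ)) := by
  obtain ⟨L, _instF, _instN, h2, hdisc⟩ := Quadratic.exists_numberField_discr_eq (D := -(D : ℤ)) (Or.inl hfund)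
  have hneg : NumberField.discr L < 0 := by rw [hdisc]; omega
  refine ⟨q, hq, L, _instF, _instN, h2, hdisc, haux, ?_, ?_, ?_, ?_, ?_, ?_, ?_⟩
  · exact (isImaginaryQuadratic_iff_discr_neg).mpr ⟨h2, hneg⟩
  · exact (Quadratic.ncard_primesOver_eq_two_iff_jacobiSym h2 Fact.out hp2).mpr (by rw [hdisc]; exact hsp)
  · by_cases hq2 : q = 2
    · subst hq2
      simpa using Quadratic.ncard_primesOver_two_eq_one_of_discr_mod_eight h2 (by rw [hdisc]; exact hin.1 rfl)
    · exact BSTWScope.ncard_primesOver_eq_one_of_jacobiSym_eq_neg_one h2 hq.out (by rw [hdisc]; exact hin.2 hq2)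
  · intro ℓ hℓ hℓq hbadℓ
    by_cases hℓ2 : ℓ = 2
    · subst hℓ2
      have h8 := (hbad 2 hℓ hℓq hbadℓ).1 rfl
      have := (Quadratic.ncard_primesOver_two_eq_two_iff h2).mpr (by rw [hdisc]; exact h8)
      simpa using this
    · exact (Quadratic.ncard_primesOver_eq_two_iff_jacobiSym h2 hℓ hℓ2).mpr
        (by rw [hdisc]; exact (hbad ℓ hℓ hℓq hbadℓ).2 hℓ2)
  · rw [hdisc]; omega
  · intro ℓ hℓ hbadℓ
    rw [hdisc, Int.dvd_neg]
    exact hbadD ℓ hℓ hbadℓ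
  · intro hgood2
    have := (Quadratic.ncard_primesOver_two_eq_two_iff h2).mpr (by rw [hdisc]; exact htwo hgood2)
    simpa using this

end Scope

/-! ### § TierMC — the two `S_tw`-scoped tiers of the twist clause at MAIN-CONJECTURE level (body wording, Thm. 10.1
l.7322; S-twins of the Literature binder `thm101_twist_signedMainStatement_OPEN` in the Summits currency) -/

section TierMC

/-- **OPEN BINDER — the `p ≥ 5` TIER of the TWIST CLAUSE of Burungale–Skinner–Tian–Wan, arXiv:2409.01350v2, Thm. 10.1
(p. 86; = the body form of Thm. 1.3's twist clause), BODY wording, ON THE TWIST SCOPE `S_tw`.** "Let `g ∈ S₂(Γ₀(N))` be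
an elliptic newform with `N` square-free, and `p ∤ 2N` a prime of supersingular reduction. Then Kobayashi's main
Conjecture 9.4 is true … Moreover, the same holds for `g_K := g ⊗ χ_K` for any quadratic field extension `K/ℚ` with
discriminant coprime to `Np`", RESTRICTED to: `p ≥ 5`, and `K = ℚ(√d)` itself an admissible auxiliary field of the
printed proof for `(E₀, p)` (`BSTWScope.IsAuxiliaryTwist W₀ p d`; road B2 of the module docstring: §10.3 run with
`L := K`, l.7465–7475). Transcribed exactly as `thm101_twist_signedMainStatement_OPEN` (`W₀` globally minimal,
`Semistable W₀`, good at `p`, `a_p(E₀) = 0`; `d ≠ 1` square-free, every prime ramified in `ℚ(√d)` is `≠ p` and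
`∤ N_{E₀}`; `W` a globally minimal model of `E₀ ⊗ χ_K = E₀^{(d)}`, `C • W = W₀.quadraticTwist d`) with `p ≠ 2`
replaced by `5 ≤ p`, the scope conjunct added, and the conclusion in the Summits currency, `KobayashiMainConjecture W p ε`
for every sign; strictly weaker than print (`thm101_twist_scopedS_OPEN_of_thm101_twist_OPEN`). UNREFEREED PREPRINT:
NEVER cite this `Prop` as a theorem; take it as an explicit hypothesis. Nothing asserted. [claim: BurungaleSkinnerTianWan2024, status: under-review]
[cite: Kobayashi2003, Conjecture (Main Conjecture) (p. 2) (shape of the conclusion only; nothing asserted)] -/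
def BurungaleSkinnerTianWan2024_thm101_twist_scopedS_OPEN : Prop :=
  ∀ (W₀ W : WeierstrassCurve ℚ) [W₀.IsElliptic] [W₀.IsGloballyMinimal] [W.IsElliptic]
    [W.IsGloballyMinimal] (p : ℕ) [Fact p.Prime] (d : ℤ) (C : VariableChange ℚ),
    5 ≤ p → Semistable W₀ → W₀.HasGoodReductionAtPrime p → W₀.frobeniusTrace p = 0 →
    Squarefree d → d ≠ 1 →
    (∀ (q : ℕ) [Fact q.Prime], RamifiedInQuadratic d q → q ≠ p ∧ ¬ q ∣ W₀.conductorNorm ℤ) →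
    C • W = W₀.quadraticTwist (d : ℚ) →
    BSTWScope.IsAuxiliaryTwist W₀ p d →
      ∀ ε : ℤˣ, KobayashiMainConjecture W p ε

/-- **OPEN BINDER — the `p = 3` TIER of the TWIST CLAUSE of Burungale–Skinner–Tian–Wan Thm. 10.1, BODY wording, ON THE
TWIST SCOPE `S_tw`.** As `…_thm101_twist_scopedS_OPEN` with `5 ≤ p` ↦ `p = 3` (the body's «supersingular» carries
`a_p(g) = 0`, §9.1 l.6679–6680, so `a₃(E₀) = 0` — the intro's (h4) — is the hypothesis `W₀.frobeniusTrace p = 0`; on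
the twist `a₃(E₀^{(d)}) = ±a₃(E₀) = 0`, kernel `frobeniusTrace_three_eq_zero_of_twistClause`). WHAT THIS TIER RESTS ON
beyond the `p ≥ 5` chain: the `p = 3` wall of record of the semistable clause (C4-R3 (β): GAP(line) at TeX l.2915 +
l.4918–4923 ⇐ [SV-S-Ohta], unpublished; referee C ROUND 469: PASS-in-cell(G♯) issued, node SINGLE-PRONG G♭ at 3),
imported unchanged by road B2 (no new `p = 3` item arises from twisting, sheet 12a33d6b09c94339 §B.3). Strictly
weaker than the printed binder (`thm101_twist_scopedAtThreeS_OPEN_of_thm101_twist_OPEN`). UNREFEREED PREPRINT resting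
at 3 on a further preprint: NEVER cite this `Prop` as a theorem; take it as an explicit hypothesis. Nothing
asserted. [claim: BurungaleSkinnerTianWan2024, status: under-review] [cite: Kobayashi2003, Conjecture (Main Conjecture) (p. 2) (shape only)] -/
def BurungaleSkinnerTianWan2024_thm101_twist_scopedAtThreeS_OPEN : Prop :=
  ∀ (W₀ W : WeierstrassCurve ℚ) [W₀.IsElliptic] [W₀.IsGloballyMinimal] [W.IsElliptic]
    [W.IsGloballyMinimal] (p : ℕ) [Fact p.Prime] (d : ℤ) (C : VariableChange ℚ),
    p = 3 → Semistable W₀ → W₀.HasGoodReductionAtPrime p → W₀.frobeniusTrace p = 0 →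
    Squarefree d → d ≠ 1 →
    (∀ (q : ℕ) [Fact q.Prime], RamifiedInQuadratic d q → q ≠ p ∧ ¬ q ∣ W₀.conductorNorm ℤ) →
    C • W = W₀.quadraticTwist (d : ℚ) →
    BSTWScope.IsAuxiliaryTwist W₀ p d →
      ∀ ε : ℤˣ, KobayashiMainConjecture W p ε

/-- The `p ≥ 5` twist tier is IMPLIED by the printed body binder `thm101_twist_signedMainStatement_OPEN` (hypotheses
added; conclusion converted by `kobayashiMainConjecture_of_signedCharIdealEq`). [claim: BurungaleSkinnerTianWan2024, status: under-review] -/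
theorem thm101_twist_scopedS_OPEN_of_thm101_twist_OPEN (h : thm101_twist_signedMainStatement_OPEN) :
    BurungaleSkinnerTianWan2024_thm101_twist_scopedS_OPEN := by
  intro W₀ W _ _ _ _ p _ d C h5 hsst hgood hap hd hd1 hram hC _ ε
  exact kobayashiMainConjecture_of_signedCharIdealEq (h W₀ W p d C (by omega) hsst hgood hap hd hd1 hram hC ε)

/-- The `p = 3` twist tier is IMPLIED by the printed body binder. [claim: BurungaleSkinnerTianWan2024, status: under-review] -/
theorem thm101_twist_scopedAtThreeS_OPEN_of_thm101_twist_OPEN (h : thm101_twist_signedMainStatement_OPEN) :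
    BurungaleSkinnerTianWan2024_thm101_twist_scopedAtThreeS_OPEN := by
  intro W₀ W _ _ _ _ p _ d C h3 hsst hgood hap hd hd1 hram hC _ ε
  exact kobayashiMainConjecture_of_signedCharIdealEq (h W₀ W p d C (by omega) hsst hgood hap hd hd1 hram hC ε)

variable (W₀ W : WeierstrassCurve ℚ) [W₀.IsElliptic] [W₀.IsGloballyMinimal] [W.IsElliptic]
  [W.IsGloballyMinimal] (p : ℕ) [Fact p.Prime]

/-- The `p ≥ 5` twist tier at a scoped twist `(W, p)` delivers the Eisenstein half `KobayashiLowerDivisibility W p ε`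
(twin of `kobayashiLowerDivisibility_of_BSTW13_twist_OPEN`). [claim: BurungaleSkinnerTianWan2024, status: under-review] -/
theorem kobayashiLowerDivisibility_of_thm101_twist_scopedS_OPEN
    (hBSTW : BurungaleSkinnerTianWan2024_thm101_twist_scopedS_OPEN) {d : ℤ} {C : VariableChange ℚ}
    (hp5 : 5 ≤ p) (hsst : Semistable W₀) (hgood : W₀.HasGoodReductionAtPrime p) (hap₀ : W₀.frobeniusTrace p = 0)
    (hd : Squarefree d) (hd1 : d ≠ 1)
    (hram : ∀ (q : ℕ) [Fact q.Prime], RamifiedInQuadratic d q → q ≠ p ∧ ¬ q ∣ W₀.conductorNorm ℤ)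
    (hC : C • W = W₀.quadraticTwist (d : ℚ)) (htw : BSTWScope.IsAuxiliaryTwist W₀ p d) (ε : ℤˣ) :
    KobayashiLowerDivisibility W p ε :=
  kobayashiLowerDivisibility_of_mainConjecture (hBSTW W₀ W p d C hp5 hsst hgood hap₀ hd hd1 hram hC htw ε)

/-- **The `p ≥ 5` twist tier, refereed in the kernel for rank `0`** (twin of `X7.bsdp_of_BSTW13_twist_OPEN_of_analyticRank_eq_zero`):
IF the tier (`hBSTW`, unrefereed) holds, then at every scoped twist `W` (a model of `E₀^{(d)}`, `(W₀, p, d) ∈ S_tw`,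
`p ≥ 5`) in class X7 with `a_p(W) = 0` and analytic rank `0`: Miller's `BSD(W, p)` — from PUBLISHED inputs by name
(Wuthrich, Kobayashi Thm. 1.2, Kim Cor. 3.15, Pollack, modularity, GZK); surjectivity of `ρ̄_{E₀^{(d)},p}` DERIVED
(`ClassX6.surj` for `W₀`, transported by `twistAdmissible_hasSurjectiveModNGaloisRep_smul_quadraticTwist` to
`C⁻¹ • W₀^{(d)} = W`). CONDITIONAL; closes nothing. [claim: BurungaleSkinnerTianWan2024, status: under-review]
[cite: Wuthrich2014, Prop. 21 (p. 400)] [cite: Serre1972, §5.4 Prop. 21 i)] [cite: SilvermanAEC2009, X.5 Cor. 5.4] -/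
theorem X7.bsdp_of_thm101_twist_scopedS_OPEN_of_analyticRank_eq_zero
    (hBSTW : BurungaleSkinnerTianWan2024_thm101_twist_scopedS_OPEN)
    (hW : Wuthrich2014.sha_dvd_analyticSha)
    (h12 : Kobayashi2003.thm12_signedSelmerDual_finite_torsion)
    (hKim : BDKim2013.cor315_signedCharValue_rankZero)
    (hmod : nonempty_modularParametrizationData) (hmod' : hasEntireLFunction_rat)
    (hGZK : rank_eq_analyticRank_of_analyticRank_le_one) {d : ℤ} {C : VariableChange ℚ}
    (hp5 : 5 ≤ p) (hsst : Semistable W₀) (hgood : W₀.HasGoodReductionAtPrime p) (hap₀ : W₀.frobeniusTrace p = 0)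
    (hd : Squarefree d) (hd1 : d ≠ 1)
    (hram : ∀ (q : ℕ) [Fact q.Prime], RamifiedInQuadratic d q → q ≠ p ∧ ¬ q ∣ W₀.conductorNorm ℤ)
    (hC : C • W = W₀.quadraticTwist (d : ℚ)) (htw : BSTWScope.IsAuxiliaryTwist W₀ p d)
    (hPollack : ∀ {N : ℕ} [NeZero N] {f : CuspForm (Gamma0 N) 2},
      pollack_exists_plusMinusPAdicLFunction (W := W) (f := f) (p := p))
    (hX : ClassX7 W p) (hap : W.frobeniusTrace p = 0) (h0 : W.analyticRank = 0) :
    BSDp W p := by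
  have hp : p ≠ 2 := by omega
  -- `W₀` is an X6 pair at `p ≥ 5`, so `ρ̄_{E₀,p}` is onto (Serre), hence so is `ρ̄_{E₀⊗χ_K,p}`
  have hX6 : ClassX6 W₀ p := ⟨⟨hgood, by rw [hap₀]; exact dvd_zero _⟩, hsst, Or.inl hp5⟩
  have hsW : Surj W₀ p := ClassX6.surj W₀ p hp hX6
  have hWC : C⁻¹ • W₀.quadraticTwist (d : ℚ) = W := by rw [← hC, inv_smul_smul]
  have hsd : Surj W p := hWC ▸
    Summit.BirchSwinnertonDyer.BirchSwinnertonDyer.Theorems.twistAdmissible_hasSurjectiveModNGaloisRep_smul_quadraticTwist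
      W₀ (by exact_mod_cast hd.ne_zero) C⁻¹ p hsW
  exact X7.bsdp_of_kobayashiLowerDivisibility_of_surj_of_analyticRank_eq_zero W p hW h12 hKim hPollack hmod hmod'
    hGZK hp hX hap hsd h0
    (kobayashiLowerDivisibility_of_thm101_twist_scopedS_OPEN W₀ W p hBSTW hp5 hsst hgood hap₀ hd hd1 hram hC htw 1)

end TierMC

/-! ### § TierPPart — the two `S_tw`-scoped tiers of the twist clause at `p`-PART level (body wording, Cor. 10.2
l.7341; S-twins of the Literature binder `cor102_twist_pPart_OPEN`) -/

section TierPPart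

/-- **OPEN BINDER — the `p ≥ 5` TIER of the TWIST CLAUSE of Burungale–Skinner–Tian–Wan Cor. 10.2 (p. 86; TeX
l.7328–7342), BODY wording, ON THE TWIST SCOPE `S_tw`.** "Let [`E/ℚ` be semistable of conductor `N`] … `p ∤ 2N` a
prime so that `a_p = 0`. If `ord_{s=1} L = r ≤ 1`, then the `p`-part of BSD is true, that is, `rank_ℤ = r`, `Ш[p^∞]`
is finite and `|L^{(r)}(1)/(r!·Ω R)|_p^{-1} = |#Ш[p^∞]·∏_{ℓ∣N} c_ℓ|_p^{-1}`. Moreover, the same holds for `E ⊗ χ_K`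
for quadratic field extensions `K/ℚ` with discriminant coprime to `Np`." (printed proof: Thm. 10.1 for `g ⊗ χ_K` plus
the PUBLISHED descents [K, §14.20] / [SU, 3.6.13] / [JSW, §7.2] (r = 0) and [Ko1], [Ko2], [BKO2, Cor. A.5] (r = 1),
l.7343–7358 — PASS-in-cell modulo PUB at any conductor, sheet 12a33d6b09c94339 V4), RESTRICTED to: `p ≥ 5`, and
`(W₀, p, d) ∈ S_tw` (`BSTWScope.IsAuxiliaryTwist W₀ p d`). Transcribed exactly as `cor102_twist_pPart_OPEN` (`W₀`
globally minimal, `Semistable W₀`, good at `p`, `a_p(W₀) = 0`; `d` square-free, `d ≠ 1`, every prime ramified in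
`ℚ(√d)` is `≠ p` and `∤ N_{E₀}`; `W` globally minimal with `C • W = W₀.quadraticTwist d`; `W.analyticRank ≤ 1` ⇒
`rank = r_an ∧ Ш(E^K)[p^∞]` finite `∧` the no-torsion print shape at `p`) with `p ≠ 2` replaced by `5 ≤ p` and the
scope conjunct added. Strictly weaker than `cor102_twist_pPart_OPEN` (`cor102_twist_scopedS_OPEN_of_cor102_twist_OPEN`).
UNREFEREED PREPRINT: NEVER cite this `Prop` as a theorem; take it as an explicit hypothesis. Nothing asserted. [claim: BurungaleSkinnerTianWan2024, status: under-review]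
[cite: Miller2011LMS, §1 and Def. 1.1 (shape of the conclusion only; nothing asserted)] -/
def BurungaleSkinnerTianWan2024_cor102_twist_scopedS_OPEN : Prop :=
  ∀ (W₀ W : WeierstrassCurve ℚ) [W₀.IsElliptic] [W₀.IsGloballyMinimal] [W.IsElliptic]
    [W.IsGloballyMinimal] (p : ℕ) [Fact p.Prime] (d : ℤ) (C : VariableChange ℚ),
    5 ≤ p → Semistable W₀ → W₀.HasGoodReductionAtPrime p → W₀.frobeniusTrace p = 0 →
    Squarefree d → d ≠ 1 →
    (∀ (q : ℕ) [Fact q.Prime], RamifiedInQuadratic d q → q ≠ p ∧ ¬ q ∣ W₀.conductorNorm ℤ) →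
    C • W = W₀.quadraticTwist (d : ℚ) →
    BSTWScope.IsAuxiliaryTwist W₀ p d →
    W.analyticRank ≤ 1 →
      W.mordellWeilRank = W.analyticRank ∧ Finite (AddCommGroup.primaryComponent W.sha p) ∧
      ∃ r : ℚ, W.leadingLCoeff / ((W.realPeriodRat * W.regulator : ℝ) : ℂ) = (r : ℂ) ∧
        padicValRat p r = (padicValNat p W.shaOrder : ℤ) + padicValNat p W.tamagawaProduct

/-- **OPEN BINDER — the `p = 3` TIER of the TWIST CLAUSE of Cor. 10.2, BODY wording, ON THE TWIST SCOPE `S_tw`.** As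
`…_cor102_twist_scopedS_OPEN` with `5 ≤ p` ↦ `p = 3` (the body's «a_p = 0» is then the intro's (1.7) `a₃ = 0`).
Rests at 3 on the `p = 3` wall of record ([SV-S-Ohta]; C4-R3 (β)). Strictly weaker than `cor102_twist_pPart_OPEN`
(`cor102_twist_scopedAtThreeS_OPEN_of_cor102_twist_OPEN`). UNREFEREED PREPRINT resting at 3 on a further preprint:
NEVER cite this `Prop` as a theorem; take it as an explicit hypothesis. Nothing asserted. [claim: BurungaleSkinnerTianWan2024, status: under-review]
[cite: Miller2011LMS, §1 and Def. 1.1 (shape of the conclusion only; nothing asserted)] -/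
def BurungaleSkinnerTianWan2024_cor102_twist_scopedAtThreeS_OPEN : Prop :=
  ∀ (W₀ W : WeierstrassCurve ℚ) [W₀.IsElliptic] [W₀.IsGloballyMinimal] [W.IsElliptic]
    [W.IsGloballyMinimal] (p : ℕ) [Fact p.Prime] (d : ℤ) (C : VariableChange ℚ),
    p = 3 → Semistable W₀ → W₀.HasGoodReductionAtPrime p → W₀.frobeniusTrace p = 0 →
    Squarefree d → d ≠ 1 →
    (∀ (q : ℕ) [Fact q.Prime], RamifiedInQuadratic d q → q ≠ p ∧ ¬ q ∣ W₀.conductorNorm ℤ) →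
    C • W = W₀.quadraticTwist (d : ℚ) →
    BSTWScope.IsAuxiliaryTwist W₀ p d →
    W.analyticRank ≤ 1 →
      W.mordellWeilRank = W.analyticRank ∧ Finite (AddCommGroup.primaryComponent W.sha p) ∧
      ∃ r : ℚ, W.leadingLCoeff / ((W.realPeriodRat * W.regulator : ℝ) : ℂ) = (r : ℂ) ∧
        padicValRat p r = (padicValNat p W.shaOrder : ℤ) + padicValNat p W.tamagawaProduct

/-- The `p ≥ 5` body tier is IMPLIED by the printed `cor102_twist_pPart_OPEN`. [claim: BurungaleSkinnerTianWan2024, status: under-review] -/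
theorem cor102_twist_scopedS_OPEN_of_cor102_twist_OPEN (h : cor102_twist_pPart_OPEN) :
    BurungaleSkinnerTianWan2024_cor102_twist_scopedS_OPEN := by
  intro W₀ W _ _ _ _ p _ d C h5 hsst hgood hap hd hd1 hram hC _ hr
  exact h W₀ W p d C (by omega) hsst hgood hap hd hd1 hram hC hr

/-- The `p = 3` body tier is IMPLIED by the printed `cor102_twist_pPart_OPEN`. [claim: BurungaleSkinnerTianWan2024, status: under-review] -/
theorem cor102_twist_scopedAtThreeS_OPEN_of_cor102_twist_OPEN (h : cor102_twist_pPart_OPEN) :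
    BurungaleSkinnerTianWan2024_cor102_twist_scopedAtThreeS_OPEN := by
  intro W₀ W _ _ _ _ p _ d C h3 hsst hgood hap hd hd1 hram hC _ hr
  exact h W₀ W p d C (by omega) hsst hgood hap hd hd1 hram hC hr

variable (W₀ W : WeierstrassCurve ℚ) [W₀.IsElliptic] [W₀.IsGloballyMinimal] [W.IsElliptic]
  [W.IsGloballyMinimal] (p : ℕ) [Fact p.Prime]

/-- **Bridge (CONDITIONAL), `p ≥ 5` body tier** (twin of `bsdp_of_cor102_twist_OPEN`): granted the tier (`hBSTW_OPEN`,
unrefereed), at every scoped twist `W` of the body clause with `p ≥ 5`, `E^K[p]` irreducible (`hirr`; automatic at a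
supersingular `p > 2`, `irr_of_twistClause` / `ClassX7.irr`) and analytic rank `≤ 1`: Miller's `BSD(W, p)` — via the
tree's bridge `bsdp_of_padicVal_printShape` (GZK `hGZK` by name). Closes nothing.
[claim: BurungaleSkinnerTianWan2024, status: under-review] [cite: Miller2011LMS, §1 and Def. 1.1] -/
theorem bsdp_of_cor102_twist_scopedS_OPEN (hBSTW_OPEN : BurungaleSkinnerTianWan2024_cor102_twist_scopedS_OPEN)
    (hGZK : rank_eq_analyticRank_of_analyticRank_le_one) {d : ℤ} {C : VariableChange ℚ}
    (hp5 : 5 ≤ p) (hsst : Semistable W₀) (hgood : W₀.HasGoodReductionAtPrime p) (hap : W₀.frobeniusTrace p = 0)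
    (hd : Squarefree d) (hd1 : d ≠ 1)
    (hram : ∀ (q : ℕ) [Fact q.Prime], RamifiedInQuadratic d q → q ≠ p ∧ ¬ q ∣ W₀.conductorNorm ℤ)
    (hC : C • W = W₀.quadraticTwist (d : ℚ)) (htw : BSTWScope.IsAuxiliaryTwist W₀ p d) (hirr : Irr W p)
    (hr : W.analyticRank ≤ 1) : BSDp W p :=
  bsdp_of_padicVal_printShape W p hGZK hr hirr
    (hBSTW_OPEN W₀ W p d C hp5 hsst hgood hap hd hd1 hram hC htw hr).2.2

/-- **Bridge (CONDITIONAL), `p = 3` body tier** (twin of `bsdp_of_cor102_twist_OPEN` at `p = 3`): granted the tier,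
at every scoped twist `W` of the body clause with `a₃(W₀) = 0`, `E^K[3]` irreducible and analytic rank `≤ 1`:
`BSD(W, 3)`. Closes nothing. [claim: BurungaleSkinnerTianWan2024, status: under-review] [cite: Miller2011LMS, §1 and Def. 1.1] -/
theorem bsdp_of_cor102_twist_scopedAtThreeS_OPEN
    (hBSTW_OPEN : BurungaleSkinnerTianWan2024_cor102_twist_scopedAtThreeS_OPEN)
    (hGZK : rank_eq_analyticRank_of_analyticRank_le_one) {d : ℤ} {C : VariableChange ℚ}
    (hp3 : p = 3) (hsst : Semistable W₀) (hgood : W₀.HasGoodReductionAtPrime p) (hap : W₀.frobeniusTrace p = 0)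
    (hd : Squarefree d) (hd1 : d ≠ 1)
    (hram : ∀ (q : ℕ) [Fact q.Prime], RamifiedInQuadratic d q → q ≠ p ∧ ¬ q ∣ W₀.conductorNorm ℤ)
    (hC : C • W = W₀.quadraticTwist (d : ℚ)) (htw : BSTWScope.IsAuxiliaryTwist W₀ p d) (hirr : Irr W p)
    (hr : W.analyticRank ≤ 1) : BSDp W p :=
  bsdp_of_padicVal_printShape W p hGZK hr hirr
    (hBSTW_OPEN W₀ W p d C hp3 hsst hgood hap hd hd1 hram hC htw hr).2.2

end TierPPart

end Summit.BirchSwinnertonDyer.Rank1Residual.Supersingular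

end
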